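import Literature.AlgebraicGeometry.Resolution.ComponentGluing
import Mathlib.AlgebraicGeometry.Morphisms.Proper
import Mathlib.AlgebraicGeometry.Morphisms.FiniteType
import Mathlib.RingTheory.Regular.RegularSequence
import Mathlib.RingTheory.KrullDimension.Basic
import HarnessLib

/-!
# Measure descent for hole #3 (`stub_genericFInjectivization`) of crux `FInjectiveMacaulayfication` — H3

[OURS · L1 W4.5a] Support file for crux stmt-ResolutionOfSingularities-15315
(`Summit.ResolutionOfSingularities.ResolutionOfSingularities.Theses.FrobeniusLadder.FInjectiveMacaulayfication`,
route `FrobeniusLadder`, registered skeleton v11 `86e9127b5c98b8e6`), helper **H3** of the crux planner's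
CRUX-PLAN (v1 §6 / v3 §C; planner draft `L/w45a/MeasureDescent.lean`, item evidence 2026-08-26T19:12Z), landed
for the stub seats and round-2 cards of hole #3 = registered stub `stub_genericFInjectivization` ("generic
F-injectivization": an integral, everywhere Cohen–Macaulay, separated finite-type `X₁/k` has a proper birational
integral everywhere-Cohen–Macaulay model on which the Frobenius-closure clause holds at every NON-CLOSED point).

This file is LOGIC ONLY — the card-independent composition spine "well-founded measure + step lemma ⇒ stub":

* §1 `exists_model_of_wellFounded_step` — abstract descent: states `σ : S` carrying schemes `X σ`, a measure
  `μ : S → W` into a well-founded relation, a target predicate `P`, and a STEP producing from every state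
  failing `P` a new state with a proper birational map `X σ' ⟶ X σ` and smaller measure; then every state
  has a proper birational model `X σ' ⟶ X σ` (a composite of steps, `IsBirational.comp`) satisfying `P`.
  States are whatever a card needs to carry along (history / boundary / markings): the measure need not be
  a function of the scheme alone.
* §2 `genericFInjectivization_of_measure` — **the planner's H3 verbatim** (abbreviations `CMClause` /
  `FClause` of the draft unfolded into the route's inline clauses): ANY well-founded order `r` on `W`, ANY
  measure `μ p k X f ∈ W` of admissible pairs and ANY step lemma «if some non-closed point of an admissible
  `(X, f)` fails the Frobenius clause there is a proper birational everywhere-CM integral modification with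
  smaller measure» yield the registered signature of `stub_genericFInjectivization` VERBATIM as the
  conclusion.  The content a card must supply is exactly `step` (and `μ`, `r`, `hwf`).
* §3 `genericFInjectivization_of_stateMeasure` — the same conclusion from a STATE-carrying step (§1 shape,
  at fixed `p`, `k`): the card chooses a type of states `S`, realises every admissible `(X₁, f₁)` as a state,
  keeps every state admissible, and steps with decreasing measure while a non-closed bad point exists.

Folklore (well-founded induction; composition of proper / birational morphisms: Mathlib instances and
`Literature.AlgebraicGeometry.Resolution.ComponentGluing.IsBirational.comp`).  No definition is declared; the
clauses are written inline in the route file's vocabulary; the file does not import the route file.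
AI-written; weaker than expert review; no statement of [claim: Hironaka2017] is used.
-/

-- single-problem summit: the doubled namespace component `ResolutionOfSingularities` is forced
set_option linter.dupNamespace false

noncomputable section

namespace Summit.ResolutionOfSingularities.ResolutionOfSingularities.Theorems.FInjectiveMacaulayfication.MeasureDescent

open CategoryTheory AlgebraicGeometry TopologicalSpace
open Literature.AlgebraicGeometry.Resolution

universe v w

/-! ## §1 Abstract descent along a well-founded measure -/

/-- **Descent along a well-founded measure (abstract form).** Let `S` be a type of states, each carrying
a scheme `X σ`, `μ : S → W` a measure into a type with a well-founded relation `r`, and `P` a target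
predicate on states.  If from every state failing `P` one can STEP to a state `σ'` with a proper birational
`X σ' ⟶ X σ` and `r (μ σ') (μ σ)`, then every state `σ` admits a state `σ'` satisfying `P` together with a
proper birational `X σ' ⟶ X σ` (the composite of the steps; the identity if `P σ`). [folklore] -/
theorem exists_model_of_wellFounded_step {S : Type v} {W : Type w} {r : W → W → Prop}
    (hwf : WellFounded r) (μ : S → W) (X : S → Scheme.{0}) (P : S → Prop)
    (step : ∀ σ : S, ¬ P σ → ∃ (σ' : S) (π : X σ' ⟶ X σ), IsProper π ∧ IsBirational π ∧ r (μ σ') (μ σ)) :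
    ∀ σ : S, ∃ (σ' : S) (π : X σ' ⟶ X σ), IsProper π ∧ IsBirational π ∧ P σ' := by
  suffices H : ∀ (m : W) (σ : S), μ σ = m →
      ∃ (σ' : S) (π : X σ' ⟶ X σ), IsProper π ∧ IsBirational π ∧ P σ' from
    fun σ => H (μ σ) σ rfl
  intro m
  induction m using hwf.induction with
  | _ m IH =>
    intro σ hσ
    by_cases hP : P σ
    · refine ⟨σ, 𝟙 (X σ), inferInstance, ⟨⊤, ?_, ?_, ?_⟩, hP⟩
      · simp
      · simp
      · infer_instance
    · obtain ⟨σ₁, π₁, hπ₁, hb₁, hlt⟩ := step σ hP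
      obtain ⟨σ₂, π₂, hπ₂, hb₂, hP₂⟩ := IH (μ σ₁) (hσ ▸ hlt) σ₁ rfl
      haveI := hπ₁
      haveI := hπ₂
      exact ⟨σ₂, π₂ ≫ π₁, inferInstance, ComponentGluing.IsBirational.comp hb₂ hb₁, hP₂⟩

/-! ## §2 The planner's H3: measure on admissible pairs -/

/-- **Measure descent ⇒ `stub_genericFInjectivization`** (CRUX-PLAN H3; registered signature of the
stub verbatim as the conclusion).  `W, r, hwf` = the card's well-founded order; `μ` = its measure of a pair
`(X, f : X ⟶ Spec k)` at `(p, k)`; `step` = its lever: for an admissible pair (separated, locally of finite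
type, quasi-compact, `X` integral, every system of parameters of every stalk weakly regular) with a
NON-CLOSED point at which some parameter ideal is not Frobenius closed, a proper birational `π : X' ⟶ X`
with `X'` integral and everywhere Cohen–Macaulay and `r (μ X' (π ≫ f)) (μ X f)`.  Proof: §1 with states =
admissible pairs. [folklore] -/
theorem genericFInjectivization_of_measure {W : Type w} (r : W → W → Prop) (hwf : WellFounded r)
    (μ : ∀ (p : ℕ) (k : Type) [Field k] (X : Scheme.{0}), (X ⟶ Spec (.of k)) → W)
    (step : ∀ (p : ℕ), p.Prime → ∀ (k : Type) [Field k] [CharP k p] (X : Scheme.{0})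
      (f : X ⟶ Spec (.of k)), IsSeparated f → LocallyOfFiniteType f → QuasiCompact f → IsIntegral X →
      (∀ x : X, ∀ d : ℕ, ringKrullDim (X.presheaf.stalk x) = d → ∀ s : Fin d → X.presheaf.stalk x,
        (Ideal.span (Set.range s)).radical.IsMaximal →
          RingTheory.Sequence.IsWeaklyRegular (X.presheaf.stalk x) (List.ofFn s)) →
      (∃ x : X, ¬ IsClosed ({x} : Set X) ∧ ¬ ∀ d : ℕ, ringKrullDim (X.presheaf.stalk x) = d →
        ∀ s : Fin d → X.presheaf.stalk x, (Ideal.span (Set.range s)).radical.IsMaximal →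
          ∀ y : X.presheaf.stalk x, (∃ e : ℕ, y ^ p ^ e ∈ Ideal.span
            ((fun z : X.presheaf.stalk x => z ^ p ^ e) ''
              (Ideal.span (Set.range s) : Set (X.presheaf.stalk x)))) → y ∈ Ideal.span (Set.range s)) →
      ∃ (X' : Scheme.{0}) (π : X' ⟶ X), IsProper π ∧ IsBirational π ∧ IsIntegral X' ∧
        (∀ x : X', ∀ d : ℕ, ringKrullDim (X'.presheaf.stalk x) = d → ∀ s : Fin d → X'.presheaf.stalk x,
          (Ideal.span (Set.range s)).radical.IsMaximal →
            RingTheory.Sequence.IsWeaklyRegular (X'.presheaf.stalk x) (List.ofFn s)) ∧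
        r (μ p k X' (π ≫ f)) (μ p k X f)) :
    ∀ (p : ℕ), p.Prime → ∀ (k : Type) [Field k] [CharP k p] (X₁ : Scheme.{0}) (f₁ : X₁ ⟶ Spec (.of k)), IsSeparated f₁ → LocallyOfFiniteType f₁ → QuasiCompact f₁ → IsIntegral X₁ → (∀ x : X₁, ∀ d : ℕ, ringKrullDim (X₁.presheaf.stalk x) = d → ∀ s : Fin d → X₁.presheaf.stalk x, (Ideal.span (Set.range s)).radical.IsMaximal → RingTheory.Sequence.IsWeaklyRegular (X₁.presheaf.stalk x) (List.ofFn s)) → ∃ (X₂ : Scheme.{0}) (π : X₂ ⟶ X₁), IsProper π ∧ Literature.AlgebraicGeometry.Resolution.IsBirational π ∧ IsIntegral X₂ ∧ (∀ x : X₂, ∀ d : ℕ, ringKrullDim (X₂.presheaf.stalk x) = d → ∀ s : Fin d → X₂.presheaf.stalk x, (Ideal.span (Set.range s)).radical.IsMaximal → RingTheory.Sequence.IsWeaklyRegular (X₂.presheaf.stalk x) (List.ofFn s)) ∧ ∀ x : X₂, ¬ IsClosed ({x} : Set X₂) → ∀ d : ℕ, ringKrullDim (X₂.presheaf.stalk x)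 = d → ∀ s : Fin d → X₂.presheaf.stalk x, (Ideal.span (Set.range s)).radical.IsMaximal → ∀ y : X₂.presheaf.stalk x, (∃ e : ℕ, y ^ p ^ e ∈ Ideal.span ((fun z : X₂.presheaf.stalk x => z ^ p ^ e) '' (Ideal.span (Set.range s) : Set (X₂.presheaf.stalk x)))) → y ∈ Ideal.span (Set.range s) := by
  intro p hp k _ _ X₁ f₁ hsep hft hqc hint hCM
  -- states: admissible pairs `(X, f)` over the fixed `k`
  let S : Type 1 := Σ X : Scheme.{0}, {f : X ⟶ Spec (.of k) // IsSeparated f ∧ LocallyOfFiniteType f ∧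
    QuasiCompact f ∧ IsIntegral X ∧ ∀ x : X, ∀ d : ℕ, ringKrullDim (X.presheaf.stalk x) = d →
      ∀ s : Fin d → X.presheaf.stalk x, (Ideal.span (Set.range s)).radical.IsMaximal →
        RingTheory.Sequence.IsWeaklyRegular (X.presheaf.stalk x) (List.ofFn s)}
  -- target predicate: the Frobenius clause at every non-closed point
  let P : S → Prop := fun σ => ∀ x : σ.1, ¬ IsClosed ({x} : Set σ.1) →
    ∀ d : ℕ, ringKrullDim (σ.1.presheaf.stalk x) = d → ∀ s : Fin d → σ.1.presheaf.stalk x,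
      (Ideal.span (Set.range s)).radical.IsMaximal → ∀ y : σ.1.presheaf.stalk x, (∃ e : ℕ, y ^ p ^ e ∈
        Ideal.span ((fun z : σ.1.presheaf.stalk x => z ^ p ^ e) ''
          (Ideal.span (Set.range s) : Set (σ.1.presheaf.stalk x)))) → y ∈ Ideal.span (Set.range s)
  have hstep : ∀ σ : S, ¬ P σ → ∃ (σ' : S) (π : σ'.1 ⟶ σ.1), IsProper π ∧ IsBirational π ∧
      r (μ p k σ'.1 σ'.2.1) (μ p k σ.1 σ.2.1) := by
    rintro ⟨X, f, hsepX, hftX, hqcX, hintX, hCMX⟩ hPσ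
    have hbad : ∃ x : X, ¬ IsClosed ({x} : Set X) ∧ ¬ ∀ d : ℕ, ringKrullDim (X.presheaf.stalk x) = d →
        ∀ s : Fin d → X.presheaf.stalk x, (Ideal.span (Set.range s)).radical.IsMaximal →
          ∀ y : X.presheaf.stalk x, (∃ e : ℕ, y ^ p ^ e ∈ Ideal.span
            ((fun z : X.presheaf.stalk x => z ^ p ^ e) ''
              (Ideal.span (Set.range s) : Set (X.presheaf.stalk x)))) → y ∈ Ideal.span (Set.range s) := by
      by_contra h
      push Not at h
      exact hPσ fun x hx => h x hx
    obtain ⟨X', π, hπ, hbir, hint', hCM', hlt⟩ := step p hp k X f hsepX hftX hqcX hintX hCMX hbad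
    haveI := hπ
    haveI := hsepX
    haveI := hftX
    haveI := hqcX
    have hsep' : IsSeparated (π ≫ f) := inferInstance
    have hft' : LocallyOfFiniteType (π ≫ f) := inferInstance
    have hqc' : QuasiCompact (π ≫ f) := inferInstance
    exact ⟨⟨X', π ≫ f, hsep', hft', hqc', hint', hCM'⟩, π, hπ, hbir, hlt⟩
  obtain ⟨⟨X₂, f₂, _, _, _, hint₂, hCM₂⟩, π, hπ, hbir, hP⟩ :=
    exists_model_of_wellFounded_step hwf (fun σ : S => μ p k σ.1 σ.2.1) (fun σ : S => σ.1) P hstep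
      ⟨X₁, f₁, hsep, hft, hqc, hint, hCM⟩
  exact ⟨X₂, π, hπ, hbir, hint₂, hCM₂, hP⟩

/-! ## §3 The same from a state-carrying step -/

/-- **State-measure descent ⇒ the conclusion of `stub_genericFInjectivization` at `(p, k, X₁, f₁)`.**
A card fixes a type of states `S` with underlying schemes `X σ` and structure maps `f σ : X σ ⟶ Spec k`
(every state admissible: `X σ` integral with every system of parameters of every stalk weakly regular —
separatedness etc. are the card's business), a measure `μ : S → W` into a well-founded relation, a STEP
«from a state with a non-closed point failing the Frobenius clause, a state `σ'` with a proper birational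
`π : X σ' ⟶ X σ` and `r (μ σ') (μ σ)`», and realises the given `X₁` as a state; then `X₁` has a proper
birational integral everywhere-Cohen–Macaulay model on which the Frobenius clause holds at every non-closed
point.  (History, boundary or markings live in `S`; compatibility `π ≫ f σ = f σ'` is not needed for the
conclusion and is left to the card.) [folklore] -/
theorem genericFInjectivization_of_stateMeasure (p : ℕ) (k : Type) [Field k] {S : Type v} {W : Type w}
    (r : W → W → Prop) (hwf : WellFounded r) (μ : S → W) (X : S → Scheme.{0})
    (adm : ∀ σ : S, IsIntegral (X σ) ∧ ∀ x : X σ, ∀ d : ℕ, ringKrullDim ((X σ).presheaf.stalk x) = d →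
      ∀ s : Fin d → (X σ).presheaf.stalk x, (Ideal.span (Set.range s)).radical.IsMaximal →
        RingTheory.Sequence.IsWeaklyRegular ((X σ).presheaf.stalk x) (List.ofFn s))
    (step : ∀ σ : S, (∃ x : X σ, ¬ IsClosed ({x} : Set (X σ)) ∧
      ¬ ∀ d : ℕ, ringKrullDim ((X σ).presheaf.stalk x) = d → ∀ s : Fin d → (X σ).presheaf.stalk x,
        (Ideal.span (Set.range s)).radical.IsMaximal → ∀ y : (X σ).presheaf.stalk x, (∃ e : ℕ, y ^ p ^ e ∈
          Ideal.span ((fun z : (X σ).presheaf.stalk x => z ^ p ^ e) ''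
            (Ideal.span (Set.range s) : Set ((X σ).presheaf.stalk x)))) → y ∈ Ideal.span (Set.range s)) →
      ∃ (σ' : S) (π : X σ' ⟶ X σ), IsProper π ∧ IsBirational π ∧ r (μ σ') (μ σ))
    (σ₁ : S) :
    ∃ (X₂ : Scheme.{0}) (π : X₂ ⟶ X σ₁), IsProper π ∧ IsBirational π ∧ IsIntegral X₂ ∧
      (∀ x : X₂, ∀ d : ℕ, ringKrullDim (X₂.presheaf.stalk x) = d → ∀ s : Fin d → X₂.presheaf.stalk x,
        (Ideal.span (Set.range s)).radical.IsMaximal →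
          RingTheory.Sequence.IsWeaklyRegular (X₂.presheaf.stalk x) (List.ofFn s)) ∧
      ∀ x : X₂, ¬ IsClosed ({x} : Set X₂) → ∀ d : ℕ, ringKrullDim (X₂.presheaf.stalk x) = d →
        ∀ s : Fin d → X₂.presheaf.stalk x, (Ideal.span (Set.range s)).radical.IsMaximal →
          ∀ y : X₂.presheaf.stalk x, (∃ e : ℕ, y ^ p ^ e ∈ Ideal.span
            ((fun z : X₂.presheaf.stalk x => z ^ p ^ e) ''
              (Ideal.span (Set.range s) : Set (X₂.presheaf.stalk x)))) → y ∈ Ideal.span (Set.range s) := by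
  let P : S → Prop := fun σ => ∀ x : X σ, ¬ IsClosed ({x} : Set (X σ)) →
    ∀ d : ℕ, ringKrullDim ((X σ).presheaf.stalk x) = d → ∀ s : Fin d → (X σ).presheaf.stalk x,
      (Ideal.span (Set.range s)).radical.IsMaximal → ∀ y : (X σ).presheaf.stalk x, (∃ e : ℕ, y ^ p ^ e ∈
        Ideal.span ((fun z : (X σ).presheaf.stalk x => z ^ p ^ e) ''
          (Ideal.span (Set.range s) : Set ((X σ).presheaf.stalk x)))) → y ∈ Ideal.span (Set.range s)
  have hstep : ∀ σ : S, ¬ P σ → ∃ (σ' : S) (π : X σ' ⟶ X σ), IsProper π ∧ IsBirational π ∧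
      r (μ σ') (μ σ) := by
    intro σ hPσ
    refine step σ ?_
    by_contra h
    push Not at h
    exact hPσ fun x hx => h x hx
  obtain ⟨σ₂, π, hπ, hbir, hP⟩ := exists_model_of_wellFounded_step hwf μ X P hstep σ₁
  exact ⟨X σ₂, π, hπ, hbir, (adm σ₂).1, (adm σ₂).2, hP⟩

end Summit.ResolutionOfSingularities.ResolutionOfSingularities.Theorems.FInjectiveMacaulayfication.MeasureDescent

end
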